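import Literature.MathematicalPhysics.QuantumLattice.MeanEnergyMinimiserConjugateRange
import Literature.MathematicalPhysics.QuantumLattice.DWaveSourceNNNHoppingEnergyDensityExists
import Literature.MathematicalPhysics.QuantumLattice.PinningFieldPairingOrder
import HarnessLib

/-!
# Infinite-volume reading of the pinning-field dictionary, I: the torus-limit sourced energy density IS the
# variational minimum over translation-invariant states, `m* = −∂⁺e_src(0)/2` for the `t–t'` model, and at a
# field `h` every translation-invariant sourced ground state has pair amplitude in `[−∂⁻e_src(h), −∂⁺e_src(h)]`

Topic `Literature/MathematicalPhysics/QuantumLattice` (namespace = path). The INFINITE-VOLUME reading of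
the `h`-axis dictionary of the Hubbard cuprate cell (`hubbard-cq`, rung CQ, rows PC-a / PC-c; sequel of
`DWaveOrderParameterRightDerivative.lean` (p5), `DWaveSourceNNNHoppingEnergyDensityExists.lean` (obsth-2:
`e_src(t',U,μ,h) = dWaveSourceEnergyDensityTT' t' U μ h`, the thermodynamic-limit ground-state energy
density of the pair-sourced `t–t'` torus `dWaveSourceTorusTT' L t' U μ h`, and its variational
characterisation over translation-invariant states), `TIGroundEnergyDensityResponse.lean` /
`PairSourcedTorusLimitResponse.lean` (hubbard-fast-lit: the sourced interaction
`hubbardTTPrimeSourcedInteraction 1 t' U μ dWaveFormFactor h`, its variational energy density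
`tiGroundEnergyDensity`, mean-energy minimisers = translation-invariant ground states, the pair amplitude
`e_P(ω) = 2 Re ω(P₀^d)`), and of the model-free `MeanEnergyMinimiserConjugateRange.lean` (p5).
Everything is PROVED; no definition, no named fact, zero compute. Both CQ anchors (`t' = 0` and
`t' = −1/4`) are covered (`t'` is a parameter); the `t' = 0` objects `dWaveOrderParameter U μ` /
`HasDWaveOrder U μ` are reached through `dWaveOrderParameterTT'_zero`.

## Contents (`E(h) := dWaveSourceEnergyDensityTT' t' U μ h`, `m* := dWaveOrderParameterTT' t' U μ`,
`Ψ_h := hubbardTTPrimeSourcedInteraction 1 t' U μ dWaveFormFactor h`, `P₀^d := localPairAt ({0} ∪ unitSteps) dWaveFormFactor 0`)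

* §1 BRIDGE: `Re ω(E^src_obs(h)) = e_{Ψ_h}(ω)` for every state (`re_expect_dWaveSourceEnergyObsTT'_eq_meanEnergy`);
  hence `tiGroundEnergyDensity Ψ_h 1 = E(h)` (`tiGroundEnergyDensity_dWaveSourced_eq`): the torus-limit
  energy density IS the variational minimum over translation-invariant states, so the two vocabularies of
  the cell (torus rows / TI states) name one function. `Ψ_0 = hubbardTTPrimeMuInteraction 1 t' U μ`.
* §2 `hasDerivWithinAt_Ioi_Iio_dWaveSourceEnergyDensityTT'` (one-sided derivatives of `E` at every `h`) and
  **`dWaveOrderParameterTT'_eq_neg_half_rightDeriv`: `m* = −∂⁺E(0)/2`** (unconditional, both `t'`).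
* §3 AT FIELD `h` (any real `h`): every minimiser `ω` of `Ψ_h` (translation-invariant infinite-volume ground
  state of the sourced model) has `−∂⁻E(h) ≤ 2 Re ω(P₀^d) ≤ −∂⁺E(h)`
  (`IsMeanEnergyMinimiser.two_mul_re_expect_localPairAt_mem_Icc`); both ends are attained; at a
  differentiability point of `E` ALL of them have `2 Re ω(P₀^d) = −E′(h) = lim_L 2 m_{L+1}(h)`
  (`IsMeanEnergyMinimiser.tendsto_two_mul_dWaveSourceDensityTT'`: the finite-torus sourced pair densities
  converge to the pair amplitude of EVERY such state) — Griffiths' theorem read in infinite volume.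
* The zero-field consequences (the quasi-average state: `m*` is the greatest `d`-wave pair amplitude of a
  translation-invariant ground state, attained; `HasDWaveOrderTT' ↔` such a state with positive amplitude
  exists) and the diagonal vanishing-source lemmas are in the sequel `DWaveOrderParameterQuasiAverageState.lean`.

## What is NOT here (honest scope)
Nothing asserts `HasDWaveOrderTT'` at any `(t', U, μ)`; no relation to finite-volume long-range order
(Koma–Tasaki's Conj. 2.10 direction is the barrier `SourcedOrderWithoutGroundStateLRO`); the ground states
here are Bratteli–Kishimoto–Robinson mean-energy minimisers (translation-invariant), not arbitrary
infinite-volume ground states. A certified window on `E` still bounds `m*` from above only.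

## References
* T. Koma, H. Tasaki, J. Stat. Phys. 76 (1994) 745–803, §1 and §2.4 (order parameter from the sourced
  Hamiltonian, volume limit first; symmetry-breaking infinite-volume ground states). [cite: KomaTasaki1994, §1]
* R. B. Griffiths, Phys. Rev. 152 (1966) 240, §II. [cite: Griffiths1966, §II]
* O. Bratteli, A. Kishimoto, D. W. Robinson, CMP 64 (1978) 41, Thm. 2. [cite: BratteliKishimotoRobinson1978, Thm. 2]
* R. B. Israel, *Convexity in the Theory of Lattice Gases* (1979), §II.1. [cite: Israel1979, §II.1 eq. (1)–(2)]
-/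

noncomputable section

namespace Literature.MathematicalPhysics.QuantumLattice

open _root_.Matrix Finset HubbardWave0 Literature.Probability.LatticeModels _root_.Filter Set
open scoped _root_.Topology ComplexOrder

/-! ### §1 Bridge: the two vocabularies name one energy density -/

section Bridge

variable (t' U μ h : ℝ)

/-- At zero coupling a pencil is its base interaction. [cite: KomaTasaki1994, §1] -/
theorem FermionInteraction.pencil_zero {d : ℕ} (Ψ₀ Ψ₁ : FermionInteraction d) :
    FermionInteraction.pencil Ψ₀ Ψ₁ 0 = Ψ₀ := by
  cases Ψ₀ with
  | mk Φ =>
    simp only [FermionInteraction.pencil, Complex.ofReal_zero, zero_smul, add_zero]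

/-- Without source the sourced `t–t'` interaction is the grand-canonical `t–t'` Hubbard interaction
`Φ(t,t',U) − μn`. [cite: KomaTasaki1994, §1] -/
theorem hubbardTTPrimeSourcedInteraction_zero_source (t tp U' μ' : ℝ) (g : Site 2 → ℝ) :
    hubbardTTPrimeSourcedInteraction t tp U' μ' g 0 = hubbardTTPrimeMuInteraction t tp U' μ' := by
  rw [hubbardTTPrimeSourcedInteraction, neg_zero, FermionInteraction.pencil_zero]

/-- **Bridge between the torus-row vocabulary and the TI-state vocabulary**: for EVERY infinite-volume state
`ω`, the real part of its expectation of the sourced local objective `E^src(t',U,μ,h)`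
(`dWaveSourceEnergyObsTT'`, whose torus translates sum to `dWaveSourceTorusTT'`) is its mean energy for the
sourced interaction `hubbardTTPrimeSourcedInteraction 1 t' U μ dWaveFormFactor h`
(`= e^{1,t',U}(ω) − μρ(ω) − h·2 Re ω(P₀^d)`). [cite: KomaTasaki1994, §1] -/
theorem InfVolFermionState.re_expect_dWaveSourceEnergyObsTT'_eq_meanEnergy (ω : InfVolFermionState 2) :
    (ω.expect dWaveSourceWindow (dWaveSourceEnergyObsTT' t' U μ h)).re =
      ω.meanEnergy (hubbardTTPrimeSourcedInteraction 1 t' U μ dWaveFormFactor h) 1 := by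
  rw [InfVolFermionState.meanEnergy_hubbardTTPrimeSourced,
    InfVolFermionState.meanEnergy_pairSourceInteraction_dWave_eq, InfVolFermionState.meanEnergy,
    InfVolFermionState.density, InfVolFermionState.densityAt]
  unfold dWaveSourceEnergyObsTT'
  have h1 : ω.expect dWaveSourceWindow (fermionEmbed (PolySite.incl thicken_subset_dWaveSourceWindow)
      ((hubbardTTPrimeFermionInteraction 1 t' U).meanEnergyObs 1)) =
      ω.expect _ ((hubbardTTPrimeFermionInteraction 1 t' U).meanEnergyObs 1) := ω.compatible _ _
  have h0 : ({0} : Finset (Site 2)) ⊆ dWaveSourceWindow :=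
    Finset.singleton_subset_iff.2 zero_mem_dWaveSourceWindow
  have hn : ∀ σ : Fin 2, fermionEmbed (PolySite.incl h0) (nAt 0 (Finset.mem_singleton_self 0) σ) =
      nAt 0 zero_mem_dWaveSourceWindow σ := fun σ => fermionEmbed_numberOp _ _ _
  have h2 : ω.expect dWaveSourceWindow (∑ σ : Fin 2, nAt 0 zero_mem_dWaveSourceWindow σ) =
      ω.expect {0} (nAt 0 (Finset.mem_singleton_self 0) 0 + nAt 0 (Finset.mem_singleton_self 0) 1) := by
    rw [← ω.compatible h0, map_add, hn, hn, Fin.sum_univ_two]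
  have h3 : ω.expect dWaveSourceWindow (fermionEmbed (PolySite.incl pairRegion_subset_dWaveSourceWindow)
      (localPairAt (insert (0 : Site 2) unitSteps) dWaveFormFactor 0)) =
      ω.expect _ (localPairAt (insert (0 : Site 2) unitSteps) dWaveFormFactor 0) := ω.compatible _ _
  have h4 : ω.expect dWaveSourceWindow (fermionEmbed (PolySite.incl pairRegion_subset_dWaveSourceWindow)
      (localPairAt (insert (0 : Site 2) unitSteps) dWaveFormFactor 0))ᴴ =
      star (ω.expect _ (localPairAt (insert (0 : Site 2) unitSteps) dWaveFormFactor 0)) := by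
    rw [ω.expect_conjTranspose, h3]
  -- the hidden `DecidableEq` instance path of the definition body differs from the canonical one: `erw`
  erw [map_sub, map_sub, map_smul, map_smul, h1, h2, map_add (ω.expect dWaveSourceWindow), h3, h4]
  simp only [Complex.sub_re, smul_eq_mul, Complex.re_ofReal_mul, Complex.add_re, map_add, Complex.star_def,
    Complex.conj_re]
  ring

/-- **The torus-limit energy density IS the variational minimum over translation-invariant states**:
`tiGroundEnergyDensity (hubbardTTPrimeSourcedInteraction 1 t' U μ dWaveFormFactor h) 1 = dWaveSourceEnergyDensityTT' t' U μ h`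
(obsth-2's variational characterisation + the bridge). [cite: BratteliKishimotoRobinson1978, Thm. 2] -/
theorem tiGroundEnergyDensity_dWaveSourced_eq :
    (hubbardTTPrimeSourcedInteraction 1 t' U μ dWaveFormFactor h).tiGroundEnergyDensity 1 =
      dWaveSourceEnergyDensityTT' t' U μ h := by
  refine le_antisymm ?_ ?_
  · obtain ⟨ω, hω, hωe⟩ := exists_re_expect_eq_dWaveSourceEnergyDensityTT' t' U μ h
    rw [← hωe, ω.re_expect_dWaveSourceEnergyObsTT'_eq_meanEnergy]
    exact (hubbardTTPrimeSourcedInteraction 1 t' U μ dWaveFormFactor h).tiGroundEnergyDensity_le_meanEnergy 1 hω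
  · refine (hubbardTTPrimeSourcedInteraction 1 t' U μ dWaveFormFactor h).le_tiGroundEnergyDensity 1 fun ω hω => ?_
    rw [← ω.re_expect_dWaveSourceEnergyObsTT'_eq_meanEnergy]
    exact dWaveSourceEnergyDensityTT'_le_re_expect t' U μ h ω hω

/-- The sourced interaction IS the pencil `Ψ₀ − hP` through the grand-canonical `t–t'` interaction with
conjugate `P = pairSourceInteraction dWaveFormFactor`, read at coupling `s = −h`; its variational energy
density along the pencil is `s ↦ E(−s)`. [cite: KomaTasaki1994, §1] -/
theorem tiGroundEnergyDensity_pencil_dWave_eq (s : ℝ) :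
    (FermionInteraction.pencil (hubbardTTPrimeMuInteraction 1 t' U μ) (pairSourceInteraction dWaveFormFactor) s).tiGroundEnergyDensity 1 =
      dWaveSourceEnergyDensityTT' t' U μ (-s) := by
  rw [← tiGroundEnergyDensity_dWaveSourced_eq, hubbardTTPrimeSourcedInteraction, neg_neg]

/-- **Certified form of "translation-invariant sourced ground state"**: `ω` minimises the mean energy of the
sourced interaction at `h` iff it is translation invariant and `Re ω(E^src_obs(h)) ≤ E(h)` (then `=`).
[cite: BratteliKishimotoRobinson1978, Thm. 2 (condition 2)] -/
theorem InfVolFermionState.isMeanEnergyMinimiser_dWaveSourced_iff (ω : InfVolFermionState 2) :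
    ω.IsMeanEnergyMinimiser (hubbardTTPrimeSourcedInteraction 1 t' U μ dWaveFormFactor h) 1 ↔
      ω.IsTranslationInvariant ∧
        (ω.expect dWaveSourceWindow (dWaveSourceEnergyObsTT' t' U μ h)).re ≤ dWaveSourceEnergyDensityTT' t' U μ h := by
  rw [InfVolFermionState.isMeanEnergyMinimiser_iff, ω.re_expect_dWaveSourceEnergyObsTT'_eq_meanEnergy,
    tiGroundEnergyDensity_dWaveSourced_eq]

end Bridge

/-! ### §2 One-sided derivatives of `E` and the closed form of the order parameter (both `t'`) -/

section Derivatives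

variable (t' U μ : ℝ)

/-- **One-sided derivatives of `E = e_src(t',U,μ,·)` exist at every real source** (concavity on `ℝ`).
[cite: KomaTasaki1994, §1] -/
theorem hasDerivWithinAt_Ioi_Iio_dWaveSourceEnergyDensityTT' (h : ℝ) :
    HasDerivWithinAt (dWaveSourceEnergyDensityTT' t' U μ)
        (derivWithin (dWaveSourceEnergyDensityTT' t' U μ) (Ioi h) h) (Ioi h) h ∧
      HasDerivWithinAt (dWaveSourceEnergyDensityTT' t' U μ)
        (derivWithin (dWaveSourceEnergyDensityTT' t' U μ) (Iio h) h) (Iio h) h := by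
  have hc := (concaveOn_dWaveSourceEnergyDensityTT' t' U μ).neg
  have hint : h ∈ interior (Set.univ : Set ℝ) := by
    rw [interior_univ]
    exact Set.mem_univ h
  have hR := (hc.differentiableWithinAt_Ioi_of_mem_interior hint).neg
  have hL := (hc.differentiableWithinAt_Iio_of_mem_interior hint).neg
  simp only [neg_neg] at hR hL
  exact ⟨hR.hasDerivWithinAt, hL.hasDerivWithinAt⟩

/-- **`m* = −∂⁺E(0)/2`** for the `t–t'` model: `dWaveOrderParameterTT' t' U μ =
−(derivWithin (dWaveSourceEnergyDensityTT' t' U μ) (Ioi 0) 0)/2` (unconditional; the `t' = 0` case is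
`dWaveOrderParameter_eq_neg_half_rightDeriv_dWaveSourceEnergyDensity`). [cite: KomaTasaki1994, §1] -/
theorem dWaveOrderParameterTT'_eq_neg_half_rightDeriv :
    dWaveOrderParameterTT' t' U μ = -(derivWithin (dWaveSourceEnergyDensityTT' t' U μ) (Ioi 0) 0) / 2 :=
  dWaveOrderParameterTT'_eq_neg_half_rightDeriv_energyDensity t' U μ
    (hasDerivWithinAt_Ioi_Iio_dWaveSourceEnergyDensityTT' t' U μ 0).1

/-- The pencil's right derivative at `−h` is minus the LEFT derivative of `E` at `h` (`s ↦ E(−s)`).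
[cite: KomaTasaki1994, §1] -/
theorem rightDeriv_pencil_dWave_eq (h : ℝ) :
    derivWithin (fun s => (FermionInteraction.pencil (hubbardTTPrimeMuInteraction 1 t' U μ)
        (pairSourceInteraction dWaveFormFactor) s).tiGroundEnergyDensity 1) (Ioi (-h)) (-h) =
      -derivWithin (dWaveSourceEnergyDensityTT' t' U μ) (Iio h) h := by
  have hf : (fun s => (FermionInteraction.pencil (hubbardTTPrimeMuInteraction 1 t' U μ)
      (pairSourceInteraction dWaveFormFactor) s).tiGroundEnergyDensity 1) =
      (dWaveSourceEnergyDensityTT' t' U μ) ∘ Neg.neg :=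
    funext fun s => tiGroundEnergyDensity_pencil_dWave_eq t' U μ s
  have hE := (hasDerivWithinAt_Ioi_Iio_dWaveSourceEnergyDensityTT' t' U μ h).2
  have hcomp : HasDerivWithinAt ((dWaveSourceEnergyDensityTT' t' U μ) ∘ Neg.neg)
      (derivWithin (dWaveSourceEnergyDensityTT' t' U μ) (Iio h) h * (-1)) (Ioi (-h)) (-h) :=
    hE.comp_of_eq (-h) (hasDerivWithinAt_neg (s := Ioi (-h)) (x := -h)) (fun s hs => by
      simp only [Set.mem_Ioi] at hs
      simp only [Set.mem_Iio]
      linarith) (neg_neg h).symm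
  rw [hf, hcomp.derivWithin (uniqueDiffWithinAt_Ioi _)]
  ring

/-- The pencil's left derivative at `−h` is minus the RIGHT derivative of `E` at `h`.
[cite: KomaTasaki1994, §1] -/
theorem leftDeriv_pencil_dWave_eq (h : ℝ) :
    derivWithin (fun s => (FermionInteraction.pencil (hubbardTTPrimeMuInteraction 1 t' U μ)
        (pairSourceInteraction dWaveFormFactor) s).tiGroundEnergyDensity 1) (Iio (-h)) (-h) =
      -derivWithin (dWaveSourceEnergyDensityTT' t' U μ) (Ioi h) h := by
  have hf : (fun s => (FermionInteraction.pencil (hubbardTTPrimeMuInteraction 1 t' U μ)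
      (pairSourceInteraction dWaveFormFactor) s).tiGroundEnergyDensity 1) =
      (dWaveSourceEnergyDensityTT' t' U μ) ∘ Neg.neg :=
    funext fun s => tiGroundEnergyDensity_pencil_dWave_eq t' U μ s
  have hE := (hasDerivWithinAt_Ioi_Iio_dWaveSourceEnergyDensityTT' t' U μ h).1
  have hcomp : HasDerivWithinAt ((dWaveSourceEnergyDensityTT' t' U μ) ∘ Neg.neg)
      (derivWithin (dWaveSourceEnergyDensityTT' t' U μ) (Ioi h) h * (-1)) (Iio (-h)) (-h) :=
    hE.comp_of_eq (-h) (hasDerivWithinAt_neg (s := Iio (-h)) (x := -h)) (fun s hs => by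
      simp only [Set.mem_Iio] at hs
      simp only [Set.mem_Ioi]
      linarith) (neg_neg h).symm
  rw [hf, hcomp.derivWithin (uniqueDiffWithinAt_Iio _)]
  ring

end Derivatives

/-! ### §3 At field `h`: the pair amplitude of every translation-invariant sourced ground state -/

section AtField

variable {t' U μ h : ℝ} {ω : InfVolFermionState 2}

/-- **RANGE at field `h`**: every translation-invariant infinite-volume ground state `ω` of the sourced
`t–t'` model at source `h` (mean-energy minimiser of `hubbardTTPrimeSourcedInteraction 1 t' U μ dWaveFormFactor h`)
has induced pair amplitude `2 Re ω(P₀^d) ∈ [−∂⁻E(h), −∂⁺E(h)]`. [cite: Griffiths1966, §II] -/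
theorem InfVolFermionState.IsMeanEnergyMinimiser.two_mul_re_expect_localPairAt_mem_Icc
    (hω : ω.IsMeanEnergyMinimiser (hubbardTTPrimeSourcedInteraction 1 t' U μ dWaveFormFactor h) 1) :
    2 * (ω.expect (pairRegion (insert (0 : Site 2) unitSteps) 0)
        (localPairAt (insert 0 unitSteps) dWaveFormFactor 0)).re ∈
      Icc (-derivWithin (dWaveSourceEnergyDensityTT' t' U μ) (Iio h) h)
        (-derivWithin (dWaveSourceEnergyDensityTT' t' U μ) (Ioi h) h) := by
  rw [← InfVolFermionState.meanEnergy_pairSourceInteraction_dWave_eq, ← rightDeriv_pencil_dWave_eq,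
    ← leftDeriv_pencil_dWave_eq]
  unfold hubbardTTPrimeSourcedInteraction at hω
  exact ⟨hω.rightDeriv_le_meanEnergy, hω.meanEnergy_le_leftDeriv⟩

/-- **UNIQUENESS off the kinks**: if `E` is differentiable at `h` with derivative `e'`, every
translation-invariant sourced ground state at `h` has `2 Re ω(P₀^d) = −e'`. [cite: Griffiths1966, §II] -/
theorem InfVolFermionState.IsMeanEnergyMinimiser.two_mul_re_expect_localPairAt_eq_of_hasDerivAt
    (hω : ω.IsMeanEnergyMinimiser (hubbardTTPrimeSourcedInteraction 1 t' U μ dWaveFormFactor h) 1) {e' : ℝ}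
    (hd : HasDerivAt (dWaveSourceEnergyDensityTT' t' U μ) e' h) :
    2 * (ω.expect (pairRegion (insert (0 : Site 2) unitSteps) 0)
        (localPairAt (insert 0 unitSteps) dWaveFormFactor 0)).re = -e' := by
  have hmem := hω.two_mul_re_expect_localPairAt_mem_Icc
  rw [hd.hasDerivWithinAt.derivWithin (uniqueDiffWithinAt_Iio h),
    hd.hasDerivWithinAt.derivWithin (uniqueDiffWithinAt_Ioi h)] at hmem
  exact le_antisymm hmem.2 hmem.1

/-- **The finite-torus sourced pair densities converge to the pair amplitude of EVERY translation-invariant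
sourced ground state**, at every differentiability point of `E`: `2·m_{L+1}(h) → 2 Re ω(P₀^d)`
(`m_L = dWaveSourceDensityTT' L t' U μ h`; Griffiths' theorem in infinite volume). [cite: Griffiths1966, §II] -/
theorem InfVolFermionState.IsMeanEnergyMinimiser.tendsto_two_mul_dWaveSourceDensityTT'
    (hω : ω.IsMeanEnergyMinimiser (hubbardTTPrimeSourcedInteraction 1 t' U μ dWaveFormFactor h) 1)
    (hd : DifferentiableAt ℝ (dWaveSourceEnergyDensityTT' t' U μ) h) :
    Tendsto (fun L : ℕ => 2 * dWaveSourceDensityTT' (L + 1) t' U μ h) atTop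
      (𝓝 (2 * (ω.expect (pairRegion (insert (0 : Site 2) unitSteps) 0)
        (localPairAt (insert 0 unitSteps) dWaveFormFactor 0)).re)) := by
  rw [hω.two_mul_re_expect_localPairAt_eq_of_hasDerivAt hd.hasDerivAt]
  have key := (tendsto_dWaveSourceDensityTT'_of_hasDerivAt_energyDensity t' U μ hd.hasDerivAt).const_mul 2
  rw [show 2 * (-deriv (dWaveSourceEnergyDensityTT' t' U μ) h / 2) = -deriv (dWaveSourceEnergyDensityTT' t' U μ) h
    by ring] at key
  exact key

variable (t' U μ h)

/-- **Both ends are ATTAINED, upper**: some translation-invariant sourced ground state at `h` has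
`2 Re ω(P₀^d) = −∂⁺E(h)`. [cite: KomaTasaki1994, §1] -/
theorem exists_isMeanEnergyMinimiser_two_mul_re_expect_localPairAt_eq_neg_rightDeriv :
    ∃ ω : InfVolFermionState 2,
      ω.IsMeanEnergyMinimiser (hubbardTTPrimeSourcedInteraction 1 t' U μ dWaveFormFactor h) 1 ∧
        2 * (ω.expect (pairRegion (insert (0 : Site 2) unitSteps) 0)
          (localPairAt (insert 0 unitSteps) dWaveFormFactor 0)).re =
          -derivWithin (dWaveSourceEnergyDensityTT' t' U μ) (Ioi h) h := by
  obtain ⟨ω, hω, hωe⟩ := FermionInteraction.exists_isMeanEnergyMinimiser_meanEnergy_eq_leftDeriv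
    (hubbardTTPrimeMuInteraction 1 t' U μ) (pairSourceInteraction dWaveFormFactor) 1 (-h)
  refine ⟨ω, hω, ?_⟩
  rw [← InfVolFermionState.meanEnergy_pairSourceInteraction_dWave_eq, hωe, leftDeriv_pencil_dWave_eq]

/-- **Both ends are ATTAINED, lower**: some translation-invariant sourced ground state at `h` has
`2 Re ω(P₀^d) = −∂⁻E(h)`. [cite: KomaTasaki1994, §1] -/
theorem exists_isMeanEnergyMinimiser_two_mul_re_expect_localPairAt_eq_neg_leftDeriv :
    ∃ ω : InfVolFermionState 2,
      ω.IsMeanEnergyMinimiser (hubbardTTPrimeSourcedInteraction 1 t' U μ dWaveFormFactor h) 1 ∧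
        2 * (ω.expect (pairRegion (insert (0 : Site 2) unitSteps) 0)
          (localPairAt (insert 0 unitSteps) dWaveFormFactor 0)).re =
          -derivWithin (dWaveSourceEnergyDensityTT' t' U μ) (Iio h) h := by
  obtain ⟨ω, hω, hωe⟩ := FermionInteraction.exists_isMeanEnergyMinimiser_meanEnergy_eq_rightDeriv
    (hubbardTTPrimeMuInteraction 1 t' U μ) (pairSourceInteraction dWaveFormFactor) 1 (-h)
  refine ⟨ω, hω, ?_⟩
  rw [← InfVolFermionState.meanEnergy_pairSourceInteraction_dWave_eq, hωe, rightDeriv_pencil_dWave_eq]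

/-- **Kinks of `E` = coexistence**: `E` is differentiable at `h` iff all translation-invariant sourced
ground states at `h` have the same pair amplitude. [cite: Griffiths1966, §II] -/
theorem differentiableAt_dWaveSourceEnergyDensityTT'_iff_forall_minimisers :
    DifferentiableAt ℝ (dWaveSourceEnergyDensityTT' t' U μ) h ↔
      ∀ ω ω' : InfVolFermionState 2,
        ω.IsMeanEnergyMinimiser (hubbardTTPrimeSourcedInteraction 1 t' U μ dWaveFormFactor h) 1 →
        ω'.IsMeanEnergyMinimiser (hubbardTTPrimeSourcedInteraction 1 t' U μ dWaveFormFactor h) 1 →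
          (ω.expect (pairRegion (insert (0 : Site 2) unitSteps) 0)
              (localPairAt (insert 0 unitSteps) dWaveFormFactor 0)).re =
            (ω'.expect (pairRegion (insert (0 : Site 2) unitSteps) 0)
              (localPairAt (insert 0 unitSteps) dWaveFormFactor 0)).re := by
  have hf : (fun s => (FermionInteraction.pencil (hubbardTTPrimeMuInteraction 1 t' U μ)
      (pairSourceInteraction dWaveFormFactor) s).tiGroundEnergyDensity 1) =
      (dWaveSourceEnergyDensityTT' t' U μ) ∘ Neg.neg :=
    funext fun s => tiGroundEnergyDensity_pencil_dWave_eq t' U μ s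
  -- differentiability of `E` at `h` ↔ of `E ∘ neg` at `−h`
  have hdiff : DifferentiableAt ℝ (dWaveSourceEnergyDensityTT' t' U μ) h ↔
      DifferentiableAt ℝ (fun s => (FermionInteraction.pencil (hubbardTTPrimeMuInteraction 1 t' U μ)
        (pairSourceInteraction dWaveFormFactor) s).tiGroundEnergyDensity 1) (-h) := by
    rw [hf]
    constructor
    · intro hd
      exact DifferentiableAt.comp (-h) (by rw [neg_neg]; exact hd) differentiable_neg.differentiableAt
    · intro hd
      have h2 : DifferentiableAt ℝ (((dWaveSourceEnergyDensityTT' t' U μ) ∘ Neg.neg) ∘ Neg.neg) h :=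
        DifferentiableAt.comp h hd differentiable_neg.differentiableAt
      have h3 : ((dWaveSourceEnergyDensityTT' t' U μ) ∘ Neg.neg) ∘ Neg.neg = dWaveSourceEnergyDensityTT' t' U μ :=
        funext fun x => by simp
      rwa [h3] at h2
  rw [hdiff, FermionInteraction.differentiableAt_tiGroundEnergyDensity_pencil_iff]
  unfold hubbardTTPrimeSourcedInteraction
  constructor
  · intro H ω ω' hω hω'
    have := H ω ω' hω hω'
    rw [InfVolFermionState.meanEnergy_pairSourceInteraction_dWave_eq,
      InfVolFermionState.meanEnergy_pairSourceInteraction_dWave_eq] at this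
    linarith
  · intro H ω ω' hω hω'
    rw [InfVolFermionState.meanEnergy_pairSourceInteraction_dWave_eq,
      InfVolFermionState.meanEnergy_pairSourceInteraction_dWave_eq, H ω ω' hω hω']

end AtField

end Literature.MathematicalPhysics.QuantumLattice

end
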